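import Mathlib.Analysis.SpecialFunctions.Pow.Asymptotics
import Mathlib.Analysis.Asymptotics.AsymptoticEquivalent
import Summits.Parity.BatemanHorn.Theorems.SoloInformedVonMangoldtSplit
import Literature.NumberTheory.Sieve.IwaniecAlmostPrimesProp1Corollary
import Literature.NumberTheory.Sieve.IwaniecAlmostPrimesVW
import Literature.NumberTheory.Sieve.DivisorBound
import Literature.NumberTheory.Sieve.ParityBatemanHornProofs

/-!
# SoloInformedThreeRangeSchema — `(R1) ∧ (R2)_ε ∧ (R3)_ε ⟹ ∑_{n ≤ x} Λ(n² + 1) ~ 𝔖 x`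

Soloist `solo-Parity-informed`, session 6 (claim C32): the kernel version of the port schema C28
(`PLAN.md` §9).  A CONDITIONAL theorem whose hypotheses `(R2)_ε`, `(R3)_ε` are open; it has no bearing on
the truth of `Summit.Parity.BatemanHorn`.  Its content is the exact bookkeeping: which three inputs the
architecture of the one proved quadratic Bateman–Horn theorem (Sawin–Shusterman over `𝔽_q[u]`,
arXiv:2008.09905, Thm 1.2 via Thm 8.1) would need over `ℤ` to give the `ψ`-form of Hardy–Littlewood's
Conjecture E with the right constant `𝔖 = hardyLittlewoodEConst`, and that nothing else is needed.

Fix `0 < ε < 1`.  With the divisor-size split of `SoloInformedVonMangoldtSplit` at level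
`D = ⌊x^{1+ε}⌋` (`ρ`, `rem` as in `Literature.NumberTheory.Sieve.Iwaniec1978`):

* `(R1)`  `-∑_{d ≤ D} μ(d) log d · ρ(d)/d → 𝔖` as `D → ∞`.  TRUE (prime ideal theorem for `ℚ(i)` with
  de la Vallée-Poussin error term — the `s = 0` derivative of `∏_p (1 - ρ(p) p^{-1-s}) = H(s)/ζ(1+s)`),
  not in the tree; carried as a hypothesis.
* `(R2)_ε`  `∑_{x^{1-ε} < d ≤ x^{1+ε}} μ(d) log d · rem(x, d) = o(x)`: Möbius-twisted level of distribution
  `x^{1+ε}` for the roots of `ν² + 1 ≡ 0 (mod d)`.  OPEN for every fixed `ε > 0` (known at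
  `x^{1+o(1)}`: the Type-I₂/I₃ sums of `SoloInformedChebyshevHooley*`; de la Bretèche–Drappeau 2020,
  Merikoski 2023, Grimmelt–Merikoski 2025).  The range `d ≤ x^{1-ε}` needs nothing
  (`abs_sum_smallRange_le`: `|rem| ≤ ρ ≤ τ`).
* `(R3)_ε`  `∑_{e ≤ 2x^{1-ε}+1} max_{y ≤ x} |∑_{n ≤ y, e ∣ n²+1} μ((n²+1)/e)| = o(x / log x)`: Möbius
  cancellation along the divisor classes — by `SoloInformedCofactorRung`/`…CofactorLiouville` these are
  Möbius sums of the cofactor quadratics `g_{e,ν}` over the root classes `n ≡ ν (mod e)`, of length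
  `x/e ≥ x^ε/3`.  OPEN already at `e = 1` (`∑_{n ≤ x} μ(n²+1) = o(x)`); over `𝔽_q[u]` this is the range
  closed by Pellet's formula (`Literature.Barriers.Parity.FunctionFieldMobiusBias`), which has no integer
  analogue.  This is the parity-sensitive input.

`isEquivalent_sum_vonMangoldt_of_threeRanges`: `(R1) ∧ (R2)_ε ∧ (R3)_ε ⟹
(∑_{1 ≤ n ≤ x} Λ(n²+1)) ~ 𝔖 · x`.  (The passage from this `ψ`-form to
`Literature.NumberTheory.Sieve.HardyLittlewoodConjE` — partial summation and the sparsity of proper prime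
powers among `n² + 1` — is classical and not part of this file.)

References: Sawin–Shusterman arXiv:2008.09905 §§1.3, 8; Iwaniec, Invent. Math. 47 (1978);
J. Merikoski, JEMS 25 (2023) 1253–1284 (p. 1254: asymptotics for the root-count level only at `x^{1+o(1)}`).
-/

namespace Summit.Parity.BatemanHorn.Theorems

open Finset Filter ArithmeticFunction Asymptotics
open scoped ArithmeticFunction.Moebius Topology
open Literature.NumberTheory.Sieve (hardyLittlewoodEConst hardyLittlewoodEConst_pos
  exists_card_divisors_le_mul_rpow)
open Literature.NumberTheory.Sieve.Iwaniec1978 (rho congrCount rem abs_rem_le_rho rho_le_card_divisors)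

/-! ### Elementary inputs -/

/-- The level `⌊x^{a}⌋` (`a > 0`) tends to infinity with `x ∈ ℕ`. -/
theorem tendsto_floor_rpow_atTop {a : ℝ} (ha : 0 < a) :
    Tendsto (fun x : ℕ => ⌊(x : ℝ) ^ a⌋₊) atTop atTop :=
  tendsto_nat_floor_atTop.comp ((tendsto_rpow_atTop ha).comp tendsto_natCast_atTop_atTop)

/-- Every cofactor occurring in the cofactor range at level `⌊x^{1+ε}⌋` is at most
`⌊2 x^{1-ε}⌋ + 1` (`x ≥ 2`, `ε ≥ 0`): from `e · ⌊x^{1+ε}⌋ < n² + 1 ≤ x² + 1`. -/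
theorem cofactor_le {ε : ℝ} (hε : 0 ≤ ε) {x : ℕ} (hx : 2 ≤ x) {n : ℕ} (hn : n ∈ Icc 1 x) {e : ℕ}
    (he : e ∈ (n ^ 2 + 1).divisors) (hD : ⌊(x : ℝ) ^ (1 + ε)⌋₊ < (n ^ 2 + 1) / e) :
    e ≤ ⌊2 * (x : ℝ) ^ (1 - ε)⌋₊ + 1 := by
  have hed : e ∣ n ^ 2 + 1 := Nat.dvd_of_mem_divisors he
  have hepos : 0 < e := Nat.pos_of_mem_divisors he
  obtain ⟨q, hq⟩ := hed
  have hqe : (n ^ 2 + 1) / e = q := by rw [hq, Nat.mul_div_cancel_left q hepos]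
  rw [hqe] at hD
  have hxR : (2 : ℝ) ≤ x := by exact_mod_cast hx
  have hx1 : (1 : ℝ) ≤ x := by linarith
  have hnx : n ^ 2 + 1 ≤ x ^ 2 + 1 := Nat.succ_le_succ (Nat.pow_le_pow_left (mem_Icc.mp hn).2 2)
  have h1 : (e : ℝ) * ⌊(x : ℝ) ^ (1 + ε)⌋₊ < (x : ℝ) ^ 2 + 1 := by
    have : e * ⌊(x : ℝ) ^ (1 + ε)⌋₊ < x ^ 2 + 1 := by
      calc e * ⌊(x : ℝ) ^ (1 + ε)⌋₊ < e * q := Nat.mul_lt_mul_of_pos_left hD hepos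
        _ = n ^ 2 + 1 := hq.symm
        _ ≤ x ^ 2 + 1 := hnx
    exact_mod_cast this
  by_contra hcon
  push Not at hcon
  have he2 : (2 : ℝ) * (x : ℝ) ^ (1 - ε) + 1 < e := by
    have h' : ((⌊2 * (x : ℝ) ^ (1 - ε)⌋₊ + 1 : ℕ) : ℝ) + 1 ≤ e := by exact_mod_cast hcon
    have h'' := Nat.lt_floor_add_one (2 * (x : ℝ) ^ (1 - ε))
    push_cast at h'
    linarith
  have hDlow : (x : ℝ) ^ (1 + ε) - 1 < ⌊(x : ℝ) ^ (1 + ε)⌋₊ := Nat.sub_one_lt_floor _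
  have hpow1 : (x : ℝ) ^ (1 - ε) ≤ x := by
    calc (x : ℝ) ^ (1 - ε) ≤ (x : ℝ) ^ (1 : ℝ) :=
          Real.rpow_le_rpow_of_exponent_le hx1 (by linarith)
      _ = x := Real.rpow_one _
  have hpow2 : (x : ℝ) ^ (1 - ε) ≤ (x : ℝ) ^ (1 + ε) :=
    Real.rpow_le_rpow_of_exponent_le hx1 (by linarith)
  have hpow3 : (x : ℝ) ^ (1 - ε) * (x : ℝ) ^ (1 + ε) = (x : ℝ) ^ 2 := by
    rw [← Real.rpow_add (by linarith), show (1 - ε) + (1 + ε) = ((2 : ℕ) : ℝ) by push_cast; ring,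
      Real.rpow_natCast]
  have hpos1 : (0 : ℝ) ≤ 2 * (x : ℝ) ^ (1 - ε) + 1 := by positivity
  have hx2 : (1 : ℝ) ≤ (x : ℝ) ^ (1 + ε) - 1 := by
    have : (x : ℝ) ≤ (x : ℝ) ^ (1 + ε) := by
      calc (x : ℝ) = (x : ℝ) ^ (1 : ℝ) := (Real.rpow_one _).symm
        _ ≤ (x : ℝ) ^ (1 + ε) := Real.rpow_le_rpow_of_exponent_le hx1 (by linarith)
    linarith
  have hprod : (2 * (x : ℝ) ^ (1 - ε) + 1) * ((x : ℝ) ^ (1 + ε) - 1)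
      < (e : ℝ) * ⌊(x : ℝ) ^ (1 + ε)⌋₊ :=
    mul_lt_mul'' he2 hDlow hpos1 (by linarith)
  nlinarith

/-- **The trivial range `d ≤ x^{1-ε}` needs no input**: `|∑ μ(d) log d · rem(x, d)| ≤ C x^{1-ε²} log x`,
with `C` the divisor-bound constant at exponent `ε` (`|rem(x,d)| ≤ ρ(d) ≤ τ(d) ≤ C d^ε`, `log d ≤ log x`,
at most `x^{1-ε}` terms). -/
theorem abs_sum_smallRange_le {ε C : ℝ} (hε : 0 < ε)
    (hC : ∀ n : ℕ, n ≠ 0 → (#n.divisors : ℝ) ≤ C * (n : ℝ) ^ ε) {x : ℕ} (hx : 1 ≤ x) (D : ℕ) :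
    |∑ d ∈ (Icc 1 D).filter (fun d : ℕ => ¬ (x : ℝ) ^ (1 - ε) < d),
        (μ d : ℝ) * Real.log d * rem (x : ℝ) d|
      ≤ C * (x : ℝ) ^ (1 - ε ^ 2) * Real.log x := by
  have hx0 : (0 : ℝ) ≤ x := by positivity
  have hx1 : (1 : ℝ) ≤ x := by exact_mod_cast hx
  have hXnn : (0 : ℝ) ≤ (x : ℝ) ^ (1 - ε) := by positivity
  set X₁ : ℕ := ⌊(x : ℝ) ^ (1 - ε)⌋₊ with hX₁
  have hsub : (Icc 1 D).filter (fun d : ℕ => ¬ (x : ℝ) ^ (1 - ε) < d) ⊆ Icc 1 X₁ := by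
    intro d hd
    simp only [mem_filter, mem_Icc, not_lt] at hd
    exact mem_Icc.mpr ⟨hd.1.1, Nat.le_floor hd.2⟩
  have hlogx : 0 ≤ Real.log x := Real.log_nonneg hx1
  have hC0 : 0 ≤ C := by
    have := hC 1 one_ne_zero
    simp at this
    linarith
  have hterm : ∀ d ∈ Icc 1 X₁, |(μ d : ℝ) * Real.log d * rem (x : ℝ) d|
      ≤ Real.log x * (C * (x : ℝ) ^ ((1 - ε) * ε)) := by
    intro d hd
    have hd1 : 1 ≤ d := (mem_Icc.mp hd).1
    have hdX : (d : ℝ) ≤ (x : ℝ) ^ (1 - ε) :=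
      (Nat.cast_le.mpr (mem_Icc.mp hd).2).trans (Nat.floor_le hXnn)
    have hdx : (d : ℝ) ≤ x := hdX.trans (by
      calc (x : ℝ) ^ (1 - ε) ≤ (x : ℝ) ^ (1 : ℝ) :=
            Real.rpow_le_rpow_of_exponent_le hx1 (by linarith)
        _ = x := Real.rpow_one _)
    have hμ : |(μ d : ℝ)| ≤ 1 := by exact_mod_cast abs_moebius_le_one
    have hlogd : |Real.log d| ≤ Real.log x := by
      rw [abs_of_nonneg (Real.log_natCast_nonneg d)]
      exact Real.log_le_log (by exact_mod_cast hd1) hdx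
    have hrem : |rem (x : ℝ) d| ≤ C * (x : ℝ) ^ ((1 - ε) * ε) := by
      calc |rem (x : ℝ) d| ≤ rho d := abs_rem_le_rho hx0 (by omega)
        _ ≤ #d.divisors := by exact_mod_cast rho_le_card_divisors d
        _ ≤ C * (d : ℝ) ^ ε := hC d (by omega)
        _ ≤ C * ((x : ℝ) ^ (1 - ε)) ^ ε :=
          mul_le_mul_of_nonneg_left (Real.rpow_le_rpow (by positivity) hdX hε.le) hC0
        _ = C * (x : ℝ) ^ ((1 - ε) * ε) := by rw [← Real.rpow_mul hx0]
    rw [abs_mul, abs_mul]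
    calc |(μ d : ℝ)| * |Real.log d| * |rem (x : ℝ) d|
        ≤ 1 * Real.log x * (C * (x : ℝ) ^ ((1 - ε) * ε)) :=
          mul_le_mul (mul_le_mul hμ hlogd (abs_nonneg _) zero_le_one) hrem (abs_nonneg _)
            (by positivity)
      _ = _ := by ring
  calc |∑ d ∈ (Icc 1 D).filter (fun d : ℕ => ¬ (x : ℝ) ^ (1 - ε) < d),
          (μ d : ℝ) * Real.log d * rem (x : ℝ) d|
      ≤ ∑ d ∈ (Icc 1 D).filter (fun d : ℕ => ¬ (x : ℝ) ^ (1 - ε) < d),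
          |(μ d : ℝ) * Real.log d * rem (x : ℝ) d| := abs_sum_le_sum_abs _ _
    _ ≤ ∑ d ∈ Icc 1 X₁, |(μ d : ℝ) * Real.log d * rem (x : ℝ) d| :=
          sum_le_sum_of_subset_of_nonneg hsub fun _ _ _ => abs_nonneg _
    _ ≤ ∑ d ∈ Icc 1 X₁, Real.log x * (C * (x : ℝ) ^ ((1 - ε) * ε)) := sum_le_sum hterm
    _ = X₁ * (Real.log x * (C * (x : ℝ) ^ ((1 - ε) * ε))) := by
          rw [sum_const, Nat.card_Icc, nsmul_eq_mul]; simp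
    _ ≤ (x : ℝ) ^ (1 - ε) * (Real.log x * (C * (x : ℝ) ^ ((1 - ε) * ε))) :=
          mul_le_mul_of_nonneg_right (Nat.floor_le hXnn) (by positivity)
    _ = C * (x : ℝ) ^ (1 - ε ^ 2) * Real.log x := by
          rw [show (1 : ℝ) - ε ^ 2 = (1 - ε) + (1 - ε) * ε by ring,
            Real.rpow_add (by positivity)]
          ring

/-- `C x^{1-ε²} log x ≤ δ x` eventually (`log x = o(x^{ε²})`). -/
theorem eventually_smallRange_le {ε C δ : ℝ} (hε : 0 < ε) (hC : 0 ≤ C) (hδ : 0 < δ) :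
    ∀ᶠ x : ℕ in atTop, C * (x : ℝ) ^ (1 - ε ^ 2) * Real.log x ≤ δ * x := by
  have hlo := (isLittleO_log_rpow_atTop (sq_pos_of_pos hε)).comp_tendsto
    tendsto_natCast_atTop_atTop
  have hev := (Asymptotics.isLittleO_iff.mp hlo) (div_pos hδ (by linarith : (0 : ℝ) < C + 1))
  filter_upwards [hev, eventually_ge_atTop 1] with x hx hx1
  have hx0 : (0 : ℝ) < x := by exact_mod_cast hx1
  simp only [Function.comp, Real.norm_eq_abs] at hx
  rw [abs_of_nonneg (Real.log_nonneg (by exact_mod_cast hx1)),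
    abs_of_nonneg (by positivity)] at hx
  have hsplit : (x : ℝ) = (x : ℝ) ^ (1 - ε ^ 2) * (x : ℝ) ^ (ε ^ 2) := by
    rw [← Real.rpow_add hx0]; simp
  calc C * (x : ℝ) ^ (1 - ε ^ 2) * Real.log x
      ≤ C * (x : ℝ) ^ (1 - ε ^ 2) * (δ / (C + 1) * (x : ℝ) ^ (ε ^ 2)) :=
        mul_le_mul_of_nonneg_left hx (by positivity)
    _ = (C / (C + 1)) * (δ * ((x : ℝ) ^ (1 - ε ^ 2) * (x : ℝ) ^ (ε ^ 2))) := by ring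
    _ ≤ 1 * (δ * ((x : ℝ) ^ (1 - ε ^ 2) * (x : ℝ) ^ (ε ^ 2))) := by
        refine mul_le_mul_of_nonneg_right ?_ (by positivity)
        rw [div_le_one (by linarith)]; linarith
    _ = δ * x := by rw [← hsplit, one_mul]

/-- Three-term triangle inequality in the shape produced by the split. -/
theorem abs_split_combo_le (p q s t : ℝ) : |-(p + q) - s - t| ≤ |p + t| + |q| + |s| := by
  have e1 := abs_sub (-(p + t) - q) s
  have e2 := abs_sub (-(p + t)) q
  rw [abs_neg] at e2
  rw [show -(p + q) - s - t = -(p + t) - q - s by ring]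
  linarith

/-! ### The schema at a fixed `x` -/

/-- **The three-range estimate at a fixed `x ≥ 3`.**  If the main-term sum is within `δ` of `S`, the
`(R2)`-range is `≤ δ x`, the trivial range is `≤ δ x`, and the Möbius sums along the divisor classes
`e ≤ 2x^{1-ε} + 1` are bounded, uniformly in the length `y ≤ x`, by `M(e)` with
`∑ M(e) ≤ (δ/16) x / log x`, then `|∑_{n ≤ x} Λ(n²+1) - S x| ≤ 4 δ x`. -/
theorem abs_sum_vonMangoldt_sub_le {ε C δ S : ℝ} (hε : 0 < ε)
    (hC : ∀ n : ℕ, n ≠ 0 → (#n.divisors : ℝ) ≤ C * (n : ℝ) ^ ε) {x : ℕ} (hx : 3 ≤ x)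
    (h1 : |(-∑ d ∈ Icc 1 ⌊(x : ℝ) ^ (1 + ε)⌋₊, (μ d : ℝ) * Real.log d * rho d / d) - S| ≤ δ)
    (h2 : |∑ d ∈ (Icc 1 ⌊(x : ℝ) ^ (1 + ε)⌋₊).filter (fun d : ℕ => (x : ℝ) ^ (1 - ε) < d),
        (μ d : ℝ) * Real.log d * rem (x : ℝ) d| ≤ δ * x)
    (h3 : C * (x : ℝ) ^ (1 - ε ^ 2) * Real.log x ≤ δ * x) (M : ℕ → ℝ)
    (hM : ∀ e ∈ Icc 1 (⌊2 * (x : ℝ) ^ (1 - ε)⌋₊ + 1), ∀ y ≤ x,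
      |∑ n ∈ (Icc 1 y).filter (fun n => e ∣ n ^ 2 + 1), (μ ((n ^ 2 + 1) / e) : ℝ)| ≤ M e)
    (h4 : ∑ e ∈ Icc 1 (⌊2 * (x : ℝ) ^ (1 - ε)⌋₊ + 1), M e ≤ δ / 16 * x / Real.log x) :
    |∑ n ∈ Icc 1 x, Λ (n ^ 2 + 1) - S * x| ≤ 4 * δ * x := by
  have hxR : (3 : ℝ) ≤ x := by exact_mod_cast hx
  have hx0 : (0 : ℝ) < x := by linarith
  have hlogx : 0 < Real.log x := Real.log_pos (by linarith)
  have hlogne : Real.log x ≠ 0 := hlogx.ne'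
  have hδ : 0 ≤ δ := le_trans (abs_nonneg _) h1
  -- two logarithms against `log x`
  have hsq : 2 * (x : ℝ) + 1 ≤ (x : ℝ) ^ 2 := by nlinarith
  have hcube : (x : ℝ) ^ 2 + 1 ≤ (x : ℝ) ^ 3 := by nlinarith
  have hlog1 : Real.log ((x : ℝ) ^ 2 + 1) ≤ 3 * Real.log x := by
    calc Real.log ((x : ℝ) ^ 2 + 1) ≤ Real.log ((x : ℝ) ^ 3) :=
          Real.log_le_log (by positivity) hcube
      _ = 3 * Real.log x := by rw [Real.log_pow]; norm_num
  have hpow : (x : ℝ) ^ (1 - ε) ≤ x := by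
    calc (x : ℝ) ^ (1 - ε) ≤ (x : ℝ) ^ (1 : ℝ) :=
          Real.rpow_le_rpow_of_exponent_le (by linarith) (by linarith)
      _ = x := Real.rpow_one _
  have hfl : (⌊2 * (x : ℝ) ^ (1 - ε)⌋₊ : ℝ) ≤ 2 * (x : ℝ) ^ (1 - ε) := Nat.floor_le (by positivity)
  have hlog2 : Real.log (((⌊2 * (x : ℝ) ^ (1 - ε)⌋₊ + 1 : ℕ) : ℝ)) ≤ 2 * Real.log x := by
    have hE' : (((⌊2 * (x : ℝ) ^ (1 - ε)⌋₊ + 1 : ℕ) : ℝ)) ≤ (x : ℝ) ^ 2 := by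
      push_cast; linarith
    calc Real.log (((⌊2 * (x : ℝ) ^ (1 - ε)⌋₊ + 1 : ℕ) : ℝ)) ≤ Real.log ((x : ℝ) ^ 2) :=
          Real.log_le_log (by positivity) hE'
      _ = 2 * Real.log x := by rw [Real.log_pow]; norm_num
  -- the level-of-distribution ranges together: `(R2)` and the trivial range
  have hrem : |∑ d ∈ Icc 1 ⌊(x : ℝ) ^ (1 + ε)⌋₊, (μ d : ℝ) * Real.log d * rem (x : ℝ) d|
      ≤ 2 * δ * x := by
    have hsmall :=
      (abs_sum_smallRange_le hε hC (by omega : 1 ≤ x) ⌊(x : ℝ) ^ (1 + ε)⌋₊).trans h3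
    rw [← sum_filter_add_sum_filter_not (Icc 1 ⌊(x : ℝ) ^ (1 + ε)⌋₊)
      (fun d : ℕ => (x : ℝ) ^ (1 - ε) < d)]
    refine (abs_add_le _ _).trans ?_
    linarith
  -- the cofactor range
  have hB : |∑ n ∈ Icc 1 x, ∑ e ∈ (n ^ 2 + 1).divisors with ⌊(x : ℝ) ^ (1 + ε)⌋₊ < (n ^ 2 + 1) / e,
      (μ ((n ^ 2 + 1) / e) : ℝ) * Real.log (((n ^ 2 + 1) / e : ℕ) : ℝ)| ≤ δ * x := by
    have hE : ∀ n ∈ Icc 1 x, ∀ e ∈ (n ^ 2 + 1).divisors,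
        ⌊(x : ℝ) ^ (1 + ε)⌋₊ < (n ^ 2 + 1) / e → e ≤ ⌊2 * (x : ℝ) ^ (1 - ε)⌋₊ + 1 :=
      fun n hn e he hD => cofactor_le hε.le (by omega) hn he hD
    have hMnn : 0 ≤ ∑ e ∈ Icc 1 (⌊2 * (x : ℝ) ^ (1 - ε)⌋₊ + 1), M e :=
      sum_nonneg fun e he => (abs_nonneg _).trans (hM e he 0 (Nat.zero_le _))
    have hcoef : 2 * (2 * Real.log ((x : ℝ) ^ 2 + 1)
        + Real.log (((⌊2 * (x : ℝ) ^ (1 - ε)⌋₊ + 1 : ℕ) : ℝ))) ≤ 16 * Real.log x := by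
      linarith
    refine (abs_cofactorRange_le x ⌊(x : ℝ) ^ (1 + ε)⌋₊ (⌊2 * (x : ℝ) ^ (1 - ε)⌋₊ + 1) M hE
      hM).trans ?_
    calc 2 * (2 * Real.log ((x : ℝ) ^ 2 + 1) + Real.log (((⌊2 * (x : ℝ) ^ (1 - ε)⌋₊ + 1 : ℕ) : ℝ)))
          * ∑ e ∈ Icc 1 (⌊2 * (x : ℝ) ^ (1 - ε)⌋₊ + 1), M e
        ≤ (16 * Real.log x) * (δ / 16 * x / Real.log x) :=
          mul_le_mul hcoef h4 hMnn (by positivity)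
      _ = δ * x := by field_simp
  -- the main term
  have hmain : |(x : ℝ) * ∑ d ∈ Icc 1 ⌊(x : ℝ) ^ (1 + ε)⌋₊, (μ d : ℝ) * Real.log d * rho d / d
      + S * x| ≤ δ * x := by
    have key : (x : ℝ) * ∑ d ∈ Icc 1 ⌊(x : ℝ) ^ (1 + ε)⌋₊, (μ d : ℝ) * Real.log d * rho d / d
        + S * x
        = -(x * ((-∑ d ∈ Icc 1 ⌊(x : ℝ) ^ (1 + ε)⌋₊, (μ d : ℝ) * Real.log d * rho d / d) - S)) := by
      ring
    rw [key, abs_neg, abs_mul, abs_of_pos hx0, mul_comm]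
    exact mul_le_mul_of_nonneg_right h1 hx0.le
  -- assemble
  rw [sum_vonMangoldt_sq_add_one_eq_split x ⌊(x : ℝ) ^ (1 + ε)⌋₊,
    sum_moebius_log_congrCount_eq x ⌊(x : ℝ) ^ (1 + ε)⌋₊]
  refine (abs_split_combo_le _ _ _ _).trans ?_
  linarith

/-! ### The schema -/

/-- **Three-range schema (C28/C32).**  For `0 < ε < 1`: `(R1)` (main term, true but not in the tree),
`(R2)_ε` (Möbius-twisted level of distribution `x^{1+ε}` for the roots of `ν²+1 ≡ 0`, open) and `(R3)_ε`
(Möbius cancellation along the divisor classes `e ∣ n²+1`, `e ≤ 2x^{1-ε}+1`, uniformly in the length —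
open, parity-sensitive) imply the `ψ`-form of Hardy–Littlewood's Conjecture E with the Bateman–Horn
constant: `∑_{1 ≤ n ≤ x} Λ(n² + 1) ~ 𝔖 x`. -/
theorem isEquivalent_sum_vonMangoldt_of_threeRanges {ε : ℝ} (hε : 0 < ε)
    (R1 : Tendsto (fun D : ℕ => -∑ d ∈ Icc 1 D, (μ d : ℝ) * Real.log d * rho d / d) atTop
      (𝓝 hardyLittlewoodEConst))
    (R2 : ∀ δ : ℝ, 0 < δ → ∀ᶠ x : ℕ in atTop,
      |∑ d ∈ (Icc 1 ⌊(x : ℝ) ^ (1 + ε)⌋₊).filter (fun d : ℕ => (x : ℝ) ^ (1 - ε) < d),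
          (μ d : ℝ) * Real.log d * rem (x : ℝ) d| ≤ δ * x)
    (R3 : ∀ δ : ℝ, 0 < δ → ∀ᶠ x : ℕ in atTop,
      ∑ e ∈ Icc 1 (⌊2 * (x : ℝ) ^ (1 - ε)⌋₊ + 1),
          (range (x + 1)).sup' nonempty_range_add_one (fun y =>
            |∑ n ∈ (Icc 1 y).filter (fun n => e ∣ n ^ 2 + 1), (μ ((n ^ 2 + 1) / e) : ℝ)|)
        ≤ δ * x / Real.log x) :
    (fun x : ℕ => ∑ n ∈ Icc 1 x, Λ (n ^ 2 + 1)) ~[atTop]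
      fun x : ℕ => hardyLittlewoodEConst * (x : ℝ) := by
  have hSpos : 0 < hardyLittlewoodEConst := hardyLittlewoodEConst_pos
  obtain ⟨C, hC1, hC⟩ := exists_card_divisors_le_mul_rpow hε
  show ((fun x : ℕ => ∑ n ∈ Icc 1 x, Λ (n ^ 2 + 1)) - fun x : ℕ => hardyLittlewoodEConst * (x : ℝ))
    =o[atTop] fun x : ℕ => hardyLittlewoodEConst * (x : ℝ)
  rw [isLittleO_iff]
  intro c hc
  set δ : ℝ := c * hardyLittlewoodEConst / 4 with hδ
  have hδpos : 0 < δ := by positivity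
  have h1 : ∀ᶠ x : ℕ in atTop,
      |(-∑ d ∈ Icc 1 ⌊(x : ℝ) ^ (1 + ε)⌋₊, (μ d : ℝ) * Real.log d * rho d / d)
        - hardyLittlewoodEConst| ≤ δ := by
    have hev := (tendsto_floor_rpow_atTop (by linarith : (0 : ℝ) < 1 + ε)).eventually
      (Metric.tendsto_nhds.mp R1 δ hδpos)
    filter_upwards [hev] with x hx
    rw [Real.dist_eq] at hx
    exact hx.le
  have h3 := eventually_smallRange_le (C := C) hε (by linarith) hδpos
  filter_upwards [h1, R2 δ hδpos, h3, R3 (δ / 16) (by positivity), eventually_ge_atTop 3]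
    with x hx1 hx2 hx3 hx4 hx
  have hx0 : (0 : ℝ) < x := by exact_mod_cast (by omega : 0 < x)
  have hM : ∀ e ∈ Icc 1 (⌊2 * (x : ℝ) ^ (1 - ε)⌋₊ + 1), ∀ y ≤ x,
      |∑ n ∈ (Icc 1 y).filter (fun n => e ∣ n ^ 2 + 1), (μ ((n ^ 2 + 1) / e) : ℝ)|
        ≤ (range (x + 1)).sup' nonempty_range_add_one (fun y =>
            |∑ n ∈ (Icc 1 y).filter (fun n => e ∣ n ^ 2 + 1), (μ ((n ^ 2 + 1) / e) : ℝ)|) :=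
    fun e _ y hy => le_sup' (fun y => |∑ n ∈ (Icc 1 y).filter (fun n => e ∣ n ^ 2 + 1),
      (μ ((n ^ 2 + 1) / e) : ℝ)|) (mem_range.mpr (Nat.lt_succ_of_le hy))
  have hest := abs_sum_vonMangoldt_sub_le hε hC hx hx1 hx2 hx3 _ hM hx4
  simp only [Pi.sub_apply, Real.norm_eq_abs]
  rw [abs_of_pos (mul_pos hSpos hx0)]
  calc _ ≤ 4 * δ * x := hest
    _ = c * (hardyLittlewoodEConst * x) := by rw [hδ]; ring

end Summit.Parity.BatemanHorn.Theorems
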